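import Literature.MathematicalPhysics.QuantumLattice.GrassmannGaussianExpectation
import Mathlib.LinearAlgebra.CliffordAlgebra.Grading
import HarnessLib

/-!
# Parity on the Grassmann algebra: even elements are central; Gaussian integration of a block preserves parity

Topic `Literature/MathematicalPhysics/QuantumLattice`.  In multiscale analysis the effective
potentials `𝒱^{(h)}` are *even* elements of the Grassmann algebra (monomials with as many `ψ⁺` as
`ψ⁻`; Benfatto–Giuliani–Mastropietro 2006, (2.17)–(2.18); Mastropietro 2008, §2.1: "the monomials
with an even number of fields commute with the whole algebra"), and this is what makes the truncated
expectations with the lower-scale fields as spectators behave like those of commuting random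
variables.  This file sets up the parity grading of `GrassmannAlgebra R ι = ⋀(ι → R)` (Mathlib's
`CliffordAlgebra.evenOdd` for the zero quadratic form) and proves:

* `commute_of_mem_evenOdd_zero`, `mem_center_of_mem_evenOdd_zero` — **even elements are central**;
* `grassmannBasis_mem_evenOdd` — the monomial `θ_s` has parity `|s| mod 2`;
  `sum_smul_grassmannBasis_mem_evenOdd`, `eq_sum_filter_of_mem_evenOdd` — an element of parity `i`
  is the sum of its components on the monomials of parity `i`;
* `berezinOn_mem_evenOdd` — partial Berezin integration over an *even* number of generators
  preserves parity; `map_mem_evenOdd_zero` — so does a substitution of generators;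
  `quadratic_mem_evenOdd_zero`, `grassmannExp_mem_evenOdd_zero`;
* `gaussOn_mem_evenOdd_zero` — **the Gaussian integration of a fermion block maps even elements to
  even elements** (the effective potential on the next scale is again even).

Everything is proved; no named fact. [folklore]

## Sources

G. Benfatto, A. Giuliani, V. Mastropietro, Ann. Henri Poincaré 7 (2006), §2.2–2.3
(`BenfattoGiulianiMastropietro2006`); V. Mastropietro, *Non-Perturbative Renormalization* (2008),
§2.1–2.3 (`Mastropietro2008`); F. A. Berezin, *The Method of Second Quantization* (1966), Ch. I §3
(`Berezin1966`).
-/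

noncomputable section

namespace Literature.MathematicalPhysics.QuantumLattice

namespace GrassmannAlgebra

open ExteriorAlgebra

variable (R : Type*) [CommRing R] {ι : Type*}

/-- The parity grading of the Grassmann algebra (`0` = even, `1` = odd). [folklore] -/
abbrev evenOdd (i : ZMod 2) : Submodule R (GrassmannAlgebra R ι) :=
  CliffordAlgebra.evenOdd (0 : QuadraticForm R (ι → R)) i

/-! ### Even elements are central -/

/-- **Even elements are central**: an element of the even part commutes with every element.
[folklore] -/
theorem commute_of_mem_evenOdd_zero {x : GrassmannAlgebra R ι} (hx : x ∈ evenOdd R 0) (y : GrassmannAlgebra R ι) :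
    Commute x y := by
  induction x, hx using CliffordAlgebra.even_induction with
  | algebraMap r => exact Algebra.commute_algebraMap_left r y
  | add x z hx hz ihx ihz => exact ihx.add_left ihz
  | ι_mul_ι_mul a b x hx ih => exact (commute_ι_mul_ι a b y).mul_left ih

/-- Even elements lie in the centre. [folklore] -/
theorem mem_center_of_mem_evenOdd_zero {x : GrassmannAlgebra R ι} (hx : x ∈ evenOdd R 0) :
    x ∈ Subalgebra.center R (GrassmannAlgebra R ι) :=
  Subalgebra.mem_center_iff.2 fun y => ((commute_of_mem_evenOdd_zero R hx y).eq).symm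

/-- The even part is closed under products. [folklore] -/
theorem mul_mem_evenOdd_zero {x y : GrassmannAlgebra R ι} (hx : x ∈ evenOdd R 0) (hy : y ∈ evenOdd R 0) :
    x * y ∈ evenOdd R 0 := by
  simpa using SetLike.mul_mem_graded hx hy

/-- The even part contains `1`. [folklore] -/
theorem one_mem_evenOdd_zero : (1 : GrassmannAlgebra R ι) ∈ evenOdd R 0 :=
  SetLike.one_mem_graded _

/-- The even part is closed under powers. [folklore] -/
theorem pow_mem_evenOdd_zero {x : GrassmannAlgebra R ι} (hx : x ∈ evenOdd R 0) (n : ℕ) : x ^ n ∈ evenOdd R 0 := by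
  simpa using SetLike.pow_mem_graded n hx

/-! ### Parity of the monomials -/

/-- A generator is odd. [folklore] -/
theorem gen_mem_evenOdd_one [DecidableEq ι] (i : ι) : gen R i ∈ evenOdd R (1 : ZMod 2) :=
  CliffordAlgebra.ι_mem_evenOdd_one _ _

/-- The monomial `θ_s` has parity `|s| mod 2`. [folklore] -/
theorem grassmannBasis_mem_evenOdd [LinearOrder ι] [Fintype ι] (s : Finset ι) :
    grassmannBasis R ι s ∈ evenOdd R (s.card : ZMod 2) := by
  rw [grassmannBasis_eq_prod_map_gen]
  have h := SetLike.list_prod_map_mem_graded (A := evenOdd R (ι := ι)) (s.sort (· ≤ ·)) (fun _ => (1 : ZMod 2)) (gen R)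
    fun i _ => gen_mem_evenOdd_one R i
  rwa [List.map_const', List.sum_replicate, Finset.length_sort, nsmul_one] at h

section Basis

variable [LinearOrder ι] [Fintype ι]

/-- A combination of monomials of parity `i` has parity `i`. [folklore] -/
theorem sum_smul_grassmannBasis_mem_evenOdd (i : ZMod 2) (c : Finset ι → R) :
    ∑ s ∈ Finset.univ.filter (fun s : Finset ι => (s.card : ZMod 2) = i), c s • grassmannBasis R ι s ∈ evenOdd R i :=
  Submodule.sum_mem _ fun s hs => Submodule.smul_mem _ _ ((Finset.mem_filter.1 hs).2 ▸ grassmannBasis_mem_evenOdd R s)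

/-- **An element of parity `i` is the sum of its components on the monomials of parity `i`.**
[folklore] -/
theorem eq_sum_filter_of_mem_evenOdd {i : ZMod 2} {x : GrassmannAlgebra R ι} (hx : x ∈ evenOdd R i) :
    x = ∑ s ∈ Finset.univ.filter (fun s : Finset ι => (s.card : ZMod 2) = i),
      (grassmannBasis R ι).repr x s • grassmannBasis R ι s := by
  classical
  have h2 : ∀ z w : ZMod 2, z = w ∨ z = w + 1 := by decide
  have h3 : ∀ z : ZMod 2, z ≠ z + 1 := by decide
  have hsplit : x = (∑ s ∈ Finset.univ.filter (fun s : Finset ι => (s.card : ZMod 2) = i),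
      (grassmannBasis R ι).repr x s • grassmannBasis R ι s) +
      ∑ s ∈ Finset.univ.filter (fun s : Finset ι => (s.card : ZMod 2) = i + 1),
        (grassmannBasis R ι).repr x s • grassmannBasis R ι s := by
    rw [← Finset.sum_union (Finset.disjoint_filter.2 fun s _ h1 h2' => h3 i (h1.symm.trans h2'))]
    conv_lhs => rw [← (grassmannBasis R ι).sum_repr x]
    refine (Finset.sum_subset (Finset.subset_univ _) fun s _ hs => ?_).symm
    exfalso
    rcases h2 (s.card : ZMod 2) i with h | h
    · exact hs (Finset.mem_union_left _ (Finset.mem_filter.2 ⟨Finset.mem_univ _, h⟩))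
    · exact hs (Finset.mem_union_right _ (Finset.mem_filter.2 ⟨Finset.mem_univ _, h⟩))
  set P0 := ∑ s ∈ Finset.univ.filter (fun s : Finset ι => (s.card : ZMod 2) = i),
      (grassmannBasis R ι).repr x s • grassmannBasis R ι s with hP0
  set P1 := ∑ s ∈ Finset.univ.filter (fun s : Finset ι => (s.card : ZMod 2) = i + 1),
      (grassmannBasis R ι).repr x s • grassmannBasis R ι s with hP1
  have hPi : P0 ∈ evenOdd R i := sum_smul_grassmannBasis_mem_evenOdd R i _
  have hPi1 : P1 ∈ evenOdd R (i + 1) := sum_smul_grassmannBasis_mem_evenOdd R (i + 1) _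
  have hboth : P1 ∈ evenOdd R i := by
    have h : P1 = x - P0 := by rw [hsplit]; abel
    rw [h]
    exact Submodule.sub_mem _ hx hPi
  have hdisj : ∀ j : ZMod 2, Disjoint (evenOdd R (ι := ι) j) (evenOdd R (j + 1)) := by
    have hc := CliffordAlgebra.evenOdd_isCompl (0 : QuadraticForm R (ι → R))
    intro j
    fin_cases j
    · exact hc.disjoint
    · exact hc.disjoint.symm
  have hzero : P1 = 0 := (Submodule.disjoint_def.1 (hdisj i)) _ hboth hPi1
  rw [hsplit, hzero, add_zero]

/-- The coordinates of an element of parity `i` on monomials of the other parity vanish. [folklore] -/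
theorem repr_eq_zero_of_mem_evenOdd {i : ZMod 2} {x : GrassmannAlgebra R ι} (hx : x ∈ evenOdd R i)
    {s : Finset ι} (hs : (s.card : ZMod 2) ≠ i) : (grassmannBasis R ι).repr x s = 0 := by
  classical
  have h := congrArg (fun y => (grassmannBasis R ι).repr y s) (eq_sum_filter_of_mem_evenOdd R hx)
  simp only [map_sum, map_smul, Module.Basis.repr_self, Finsupp.coe_finsetSum, Finsupp.coe_smul,
    Finset.sum_apply, Pi.smul_apply, Finsupp.single_apply, smul_eq_mul, mul_ite, mul_one, mul_zero,
    Finset.sum_ite_eq', Finset.mem_filter, Finset.mem_univ, true_and] at h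
  rwa [if_neg hs] at h

/-! ### Operations preserving parity -/

/-- **Partial Berezin integration over an even number of generators preserves parity.** [folklore] -/
theorem berezinOn_mem_evenOdd {s : Finset ι} (hs : Even s.card) {i : ZMod 2} {x : GrassmannAlgebra R ι}
    (hx : x ∈ evenOdd R i) : berezinOn R s x ∈ evenOdd R i := by
  classical
  rw [eq_sum_filter_of_mem_evenOdd R hx, map_sum]
  refine Submodule.sum_mem _ fun t ht => ?_
  rw [map_smul, berezinOn_grassmannBasis]
  split_ifs with hst
  · refine Submodule.smul_mem _ _ (Submodule.smul_mem _ _ ?_)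
    have hcard : ((t \ s).card : ZMod 2) = i := by
      rw [Finset.card_sdiff_of_subset hst, Nat.cast_sub (Finset.card_le_card hst), (Finset.mem_filter.1 ht).2,
        (ZMod.natCast_eq_zero_iff_even).2 hs, sub_zero]
    exact hcard ▸ grassmannBasis_mem_evenOdd R (t \ s)
  · rw [smul_zero]; exact Submodule.zero_mem _

end Basis

/-- **A substitution of generators preserves the even part**: `ExteriorAlgebra.map f` maps even
elements to even elements. [folklore] -/
theorem map_mem_evenOdd_zero {κ : Type*} (f : (ι → R) →ₗ[R] (κ → R)) {x : GrassmannAlgebra R ι}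
    (hx : x ∈ evenOdd R 0) : ExteriorAlgebra.map f x ∈ evenOdd R 0 := by
  induction x, hx using CliffordAlgebra.even_induction with
  | algebraMap r => rw [AlgHom.commutes]; exact SetLike.algebraMap_mem_graded _ _
  | add x z hx hz ihx ihz => rw [map_add]; exact Submodule.add_mem _ ihx ihz
  | ι_mul_ι_mul a b x hx ih =>
    rw [map_mul, map_mul]
    have ha : ExteriorAlgebra.map f (ExteriorAlgebra.ι R a) = ExteriorAlgebra.ι R (f a) := ExteriorAlgebra.map_apply_ι _ _
    have hb : ExteriorAlgebra.map f (ExteriorAlgebra.ι R b) = ExteriorAlgebra.ι R (f b) := ExteriorAlgebra.map_apply_ι _ _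
    rw [ha, hb]
    exact mul_mem_evenOdd_zero R (by simpa using CliffordAlgebra.ι_mul_ι_mem_evenOdd_zero (0 : QuadraticForm R (κ → R)) (f a) (f b)) ih

/-- `ψ̄ᵢ ψⱼ` is even. [folklore] -/
theorem psiBar_mul_psi_mem_evenOdd_zero [LinearOrder ι] (i j : ι) : psiBar R i * psi R j ∈ evenOdd R (ι := ι ⊕ₗ ι) 0 :=
  CliffordAlgebra.ι_mul_ι_mem_evenOdd_zero _ _ _

/-- The quadratic action `ψ̄Aψ` is even. [folklore] -/
theorem quadratic_mem_evenOdd_zero [LinearOrder ι] [Fintype ι] (A : Matrix ι ι R) : quadratic R A ∈ evenOdd R (ι := ι ⊕ₗ ι) 0 :=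
  Submodule.sum_mem _ fun i _ => Submodule.sum_mem _ fun j _ => Submodule.smul_mem _ _ (psiBar_mul_psi_mem_evenOdd_zero R i j)

/-- The exponential of an even nilpotent element is even. [folklore] -/
theorem grassmannExp_mem_evenOdd_zero [Algebra ℚ R] {x : GrassmannAlgebra R ι} (hx : x ∈ evenOdd R 0) (hn : IsNilpotent x) :
    grassmannExp x ∈ evenOdd R 0 := by
  obtain ⟨k, hk⟩ := hn
  rw [grassmannExp, IsNilpotent.exp_eq_sum hk]
  exact Submodule.sum_mem _ fun n _ => Submodule.smul_mem _ _ (pow_mem_evenOdd_zero R hx n)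

/-- `e^{ψ̄Aψ}` is even. [folklore] -/
theorem grassmannExp_quadratic_mem_evenOdd_zero [Algebra ℚ R] [Fintype ι] [LinearOrder ι] (A : Matrix ι ι R) :
    grassmannExp (quadratic R A) ∈ evenOdd R (ι := ι ⊕ₗ ι) 0 :=
  grassmannExp_mem_evenOdd_zero R (quadratic_mem_evenOdd_zero R A) (isNilpotent_quadratic R A)

end GrassmannAlgebra

/-! ### The Gaussian integration of a block preserves parity -/

section Gauss

open GrassmannAlgebra

variable (R : Type*) [CommRing R] [Algebra ℚ R] {ι : Type*} [LinearOrder ι] [Fintype ι]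
  {J : Type*} [LinearOrder J] [Fintype J]

omit [Algebra ℚ R] [Fintype J] in
/-- A fermion block `e(ι ⊕ₗ ι)` has an even number of generators. [folklore] -/
theorem even_card_map_block (e : ι ⊕ₗ ι ↪o J) : Even (Finset.univ.map e.toEmbedding).card := by
  rw [Finset.card_map, Finset.card_univ, show Fintype.card (ι ⊕ₗ ι) = Fintype.card (ι ⊕ ι) from rfl, Fintype.card_sum]
  exact ⟨_, rfl⟩

/-- **The Gaussian integration of a fermion block maps even elements to even elements**: the
effective potential produced by integrating the fields of one scale, the lower-scale fields being
spectators, is again even (Benfatto–Giuliani–Mastropietro 2006, (2.17)–(2.18), (2.31)). [cite: BenfattoGiulianiMastropietro2006, §2.3 (2.17)-(2.18)] -/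
theorem gaussOn_mem_evenOdd_zero (e : ι ⊕ₗ ι ↪o J) (A : Matrix ι ι R) {x : GrassmannAlgebra R J}
    (hx : x ∈ evenOdd R 0) : gaussOn R e A x ∈ evenOdd R 0 := by
  rw [gaussOn_apply]
  exact berezinOn_mem_evenOdd R (even_card_map_block e) (mul_mem_evenOdd_zero R
    (map_mem_evenOdd_zero R _ (grassmannExp_quadratic_mem_evenOdd_zero R A)) hx)

/-- Hence the block integration of an even element is central. [folklore] -/
theorem gaussOn_mem_center (e : ι ⊕ₗ ι ↪o J) (A : Matrix ι ι R) {x : GrassmannAlgebra R J}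
    (hx : x ∈ evenOdd R 0) : gaussOn R e A x ∈ Subalgebra.center R (GrassmannAlgebra R J) :=
  mem_center_of_mem_evenOdd_zero R (gaussOn_mem_evenOdd_zero R e A hx)

end Gauss

end Literature.MathematicalPhysics.QuantumLattice
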